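import Literature.NumberTheory.EllipticCurves.GreenbergVatsal2000.GreenbergSelmerGroups
import Literature.NumberTheory.EllipticCurves.Tamagawa
import HarnessLib

/-!
# Greenberg–Vatsal, *On the Iwasawa invariants of elliptic curves* (Invent. Math. 142 (2000)),
# §2 Prop. (2.5) (p. 23) and the proof of Prop. (2.8) (p. 25): at `μ = 0` the non-primitive
# Greenberg-datum Selmer group `S^{Σ₀}_A(ℚ_∞)` is DIVISIBLE

HONEST FRAMING (BSD rank-`≤ 1` residual cell `b2b-bsdres`, home
`run/shared/lean/b2b/bsd-rank1-residual/`, unit `b2b-bsdres-eisenstein-p2`, class X2 = odd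
multiplicative Eisenstein primes): the cell deletes the COMBINATION-SHAPED residual classes of the
rank-`≤ 1` BSD formula from PUBLISHED theorems only and TYPES the construction-shaped ones; this is
not "finishing BSD". This file records ONE published statement as a named fact (`def … : Prop`,
nothing asserted; D-0014/D-0026): Greenberg–Vatsal's Prop. (2.5) in the consequence form they use
on p. 25 — for the Greenberg-datum Selmer groups of `A = E[p^∞]` (Literature objects
`datumSelmerInfty`, file `GreenbergSelmerGroups`): if `S^{Σ₀}_A(ℚ_∞)[p]` is finite (= "`Λ`-cotorsion
with `μ`-invariant `0`", p. 25), `D = A/C` is unramified and `Σ₀ ⊇ Ram(A)`, then `S^{Σ₀}_A(ℚ_∞)` is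
`p`-divisible. The sibling for the classical non-primitive Selmer group at a good ordinary prime is
A116 (`divisible_nonPrimitiveSelmerInfty_of_mu_eq_zero`, file `NonPrimitiveSelmerDivisible`); this
datum form is what the cell's route G needs at a prime `p ‖ N` (Tate datum `C ≅ μ_{p^∞}`,
`D ≅ ℚ_p/ℤ_p(φ)` unramified — GV p. 14), where at a split prime `S^{Σ₀}_A ⊋ Sel^{Σ₀}` (trivial zero).

## Citation header (read by this seat on the held text arXiv:math/9906215 =
## `paper:arxiv-math_9906215`, decoded by the cell, `b2b-bsdres-lit/u1/gv2000_decoded.txt`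
## p0045–p0049 = pp. 22–26 of the arXiv typescript)

* Prop. (2.5), p. 23: "Let `p` be an odd prime. Assume that `S_A(ℚ_∞)` is `Λ`-cotorsion and that
  `D` is unramified for the action of `G_{ℚ_p}`. Suppose that `Σ₀` is a subset of `Σ − {p, ∞}` which
  contains `Ram(A)`. Then `S^{Σ₀}_A(ℚ_∞)^` has no nonzero, finite `Λ`-submodules."
* Remark (2.7), p. 24: "In proposition 2.5, it is not necessary to assume that `D` is unramified for
  the action of `G_{ℚ_p}`. In the above proof, only two properties of `D` were actually used. First,
  that `Hom_{G_{ℚ_p}}(D[π], μ_p) = 0` … Second, that `D^{I_p}` is `O`-cofree".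
* Proof of Prop. (2.8), p. 25: "Now `S_A(ℚ_∞)` and `S^{Σ₀}_A(ℚ_∞)` have the same `Λ`-corank and the
  same `μ`-invariant if they are `Λ`-cotorsion. Obviously, `S^{Σ₀}_A(ℚ_∞)` is `Λ`-cotorsion and has
  `μ`-invariant `0` if and only if `S^{Σ₀}_A(ℚ_∞)[π]` is finite … Assuming this is so,
  `S^{Σ₀}_A(ℚ_∞)^` would be a finitely generated `O`-module. By Proposition (2.5) its `O`-torsion
  submodule is `0`, and so `S^{Σ₀}_A(ℚ_∞)` is `O`-divisible. That is, `S^{Σ₀}_A(ℚ_∞) ≅ (F_p/O)^λ`,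
  where `λ = corank_O(S^{Σ₀}_A(ℚ_∞))`".
* Setting (§2 p. 16): `A = V_p/T_p`, `C` = image of a `G_{ℚ_p}`-invariant subspace `W_p` of dimension
  `d⁺`, `D = A/C`; (p. 26) for `E`: "`A = V_p/T_p` is isomorphic to `E[p^∞]` … `O = ℤ_p`, `d⁺ = d⁻ = 1`".

## The tree's vocabulary (no new definition)

`E/ℚ` elliptic (`W.IsElliptic`), `A = E[p^∞] = W.geomPrimaryTorsion p`, `p` odd, `κ : ZpExtension ℚ p`
cyclotomic (`ℚ_∞ = ℚ̄^{ker κ}`), Greenberg data `L : GreenbergSelmer.Data ℚ A p` with `C = (L v hv).plus`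
divisible and `#(C ⊓ A[p]) = p` (`C` = image of a `G_{ℚ_p}`-line, `d⁺ = 1`) and `D = (L v hv).Gr`
unramified (`x • m - m ∈ C` for `x ∈ inertia v`); `S^{Σ₀}_A(ℚ_∞) = datumSelmerInfty κ A L Σ₀`
(file `GreenbergSelmerGroups`); `Σ₀ ⊇ Ram(A) − {p}` as "every `v ∉ Σ₀`, `v ∤ p` is of good reduction"
(Néron–Ogg–Shafarevich).
-/

noncomputable section

open scoped Classical AddSubgroup

open NumberField IsDedekindDomain Field
open Literature.NumberTheory.EllipticCurves Literature.NumberTheory.EllipticCurves.GreenbergSelmer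
  Literature.NumberTheory.GaloisRepresentations
  Literature.NumberTheory.EllipticCurves.GreenbergVatsal2000

universe u

namespace Literature.NumberTheory.EllipticCurves.GreenbergVatsal2000

/-- **Greenberg–Vatsal 2000, Prop. (2.5) (p. 23) with the last paragraph of the proof of
Prop. (2.8) (p. 25): at `μ = 0` the non-primitive Greenberg-datum Selmer group `S^{Σ₀}_A(ℚ_∞)` is
DIVISIBLE.** Prop. (2.5): "Let `p` be an odd prime. Assume that `S_A(ℚ_∞)` is `Λ`-cotorsion and
that `D` is unramified for the action of `G_{ℚ_p}`. Suppose that `Σ₀` is a subset of `Σ − {p, ∞}`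
which contains `Ram(A)`. Then `S^{Σ₀}_A(ℚ_∞)^` has no nonzero, finite `Λ`-submodules." Proof of
(2.8), p. 25: "Obviously, `S^{Σ₀}_A(ℚ_∞)` is `Λ`-cotorsion and has `μ`-invariant `0` if and only if
`S^{Σ₀}_A(ℚ_∞)[π]` is finite … Assuming this is so, `S^{Σ₀}_A(ℚ_∞)^` would be a finitely generated
`O`-module. By Proposition (2.5) its `O`-torsion submodule is `0`, and so `S^{Σ₀}_A(ℚ_∞)` is
`O`-divisible. That is, `S^{Σ₀}_A(ℚ_∞) ≅ (F_p/O)^λ`". (Remark (2.7): only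
"`Hom_{G_{ℚ_p}}(D[π], μ_p) = 0`" and "`D^{I_p}` is `O`-cofree" are used; Remark (2.9).) In the tree's
vocabulary, for GV's §2 setting specialised to `A = E[p^∞]` of an elliptic curve `E/ℚ` (`O = ℤ_p`,
`d = 2`, `d^± = 1`; GV p. 26): `p` an ODD prime, `κ` the cyclotomic `ℤ_p`-extension (`ℚ_∞`),
Greenberg data `L` above `p` whose `C = M⁺` is the image of a `G_{ℚ_p}`-invariant LINE — `C`
divisible with `#(C ∩ A[p]) = p` — and whose quotient `D = A/C` is UNRAMIFIED (the inertia group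
acts trivially on `D`), a finite set `Σ₀ ∌ p` of places with every `v ∉ Σ₀ ∪ {p}` of good reduction
(so `Σ₀ ⊇ Ram(A) − {p}`, Néron–Ogg–Shafarevich): IF `S^{Σ₀}_A(ℚ_∞)[p]` is finite THEN
`S^{Σ₀}_A(ℚ_∞)` is `p`-divisible.
-- TODO(general form): GV prove Prop. (2.5) — no nonzero finite `Λ`-submodule in the Pontryagin
-- dual — for `A = V_p/T_p` of any `p`-adic representation under "`S_A(ℚ_∞)` cotorsion"; only its
-- divisibility consequence at `μ = 0` (p. 25) is transcribed, with cotorsion-and-`μ = 0` in the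
-- printed equivalent form "`S^{Σ₀}_A(ℚ_∞)[p]` finite" (p. 25 "Obviously"), for `A = E[p^∞]`.
[cite: GreenbergVatsal2000, §2 Prop. (2.5) p. 23, proof of Prop. (2.8) p. 25, Remarks (2.7), (2.9)] -/
def datumSelmer_divisible_of_finite_torsionBy : Prop :=
  ∀ (W : WeierstrassCurve ℚ) [W.IsElliptic] (p : ℕ) [Fact p.Prime] (_hp : p ≠ 2)
    (κ : ZpExtension ℚ p) (_hκ : κ.IsCyclotomic)
    (L : Data ℚ (W.geomPrimaryTorsion p) p)
    (_hC : ∀ (v : HeightOneSpectrum (𝓞 ℚ)) (hv : ((p : ℕ) : 𝓞 ℚ) ∈ v.asIdeal),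
      (∀ c ∈ (L v hv).plus, ∃ c' ∈ (L v hv).plus, p • c' = c) ∧
        Nat.card ↥((L v hv).plus ⊓ (↥(W.geomPrimaryTorsion p))[(p : ℤ)]) = p)
    (_hD : ∀ (v : HeightOneSpectrum (𝓞 ℚ)) (hv : ((p : ℕ) : 𝓞 ℚ) ∈ v.asIdeal),
      ∀ x ∈ inertia v, ∀ m : W.geomPrimaryTorsion p, x • m - m ∈ (L v hv).plus)
    (S₀ : Finset (HeightOneSpectrum (𝓞 ℚ)))
    (_hS₀ : ∀ v ∈ S₀, ((p : ℕ) : 𝓞 ℚ) ∉ v.asIdeal)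
    (_hram : ∀ v : HeightOneSpectrum (𝓞 ℚ), v ∉ S₀ → ((p : ℕ) : 𝓞 ℚ) ∉ v.asIdeal →
      W.HasGoodReductionAt v),
    Finite ↥(datumSelmerInfty κ (W.geomPrimaryTorsion p) L (↑S₀ : Set (HeightOneSpectrum (𝓞 ℚ))) ⊓
        (subgroupH1 κ.kerSubgroup (W.geomPrimaryTorsion p))[(p : ℤ)]) →
      ∀ s ∈ datumSelmerInfty κ (W.geomPrimaryTorsion p) L (↑S₀ : Set (HeightOneSpectrum (𝓞 ℚ))),
        ∃ t ∈ datumSelmerInfty κ (W.geomPrimaryTorsion p) L (↑S₀ : Set (HeightOneSpectrum (𝓞 ℚ))),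
          p • t = s

end Literature.NumberTheory.EllipticCurves.GreenbergVatsal2000

end
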